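import Summits.CriticalPhenomena.SAWScalingLimit.Theorems.SAWLoopFugacityFlowAvoidanceLimitAnchorDefs
import Literature.Probability.RandomPlanarGeometry.HammersleyWelshBound
import Literature.Probability.LatticeModels.DiluteLoopModelSAW
import Mathlib.Analysis.Calculus.IteratedDeriv.Defs
import Mathlib.Analysis.Calculus.Deriv.Polynomial
import Mathlib.Algebra.Polynomial.Derivative

/-!
# The SAW point of the intrinsic critical curve, `x_c(0, 0) = 1/μ(ℤ²)` — stub `stub_sawCriticalPoint`
of line `symplectic-fermion-anchor` (crux `SAWLoopFugacityFlow.AvoidanceLimit`, stmt-CriticalPhenomena-10649)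

At `(n, t) = (0, 0)` the dressed SAW `Z_{n,t,x}` of the Defs module is the tree's strictly dilute loop
model `⟨0, 0, x⟩` (only the empty dimer configuration survives the factor `(0·x²)^{|M|}`), whose
two-leg function on a subgraph of `ℤ²` is the generating function of self-avoiding paths
(`DiluteLoopModel.partitionFunction_zero_zero_eq_sum_paths`, `partitionFunction_zero_zero_empty`).
Hence the half-plane susceptibility of the box `Λ_k = [-k, k] × [0, k]` is the polynomial
`P_k(x) = Σ_γ x^{|γ|}` over the self-avoiding walks `γ` from `0` inside `Λ_k`, and its `k`-th Taylor
coefficient at `0`, `chiCoeff 0 0 k`, is `h⁺_k`, the number of `k`-step self-avoiding walks from `0`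
in the closed upper half-plane (every such walk lies in `Λ_k`). Vertical bridges are such walks and
such walks are self-avoiding walks, so `b_k ≤ h⁺_k ≤ c_k`; with the tree's Hammersley–Welsh bounds
`e^{-c√k} μ^k ≤ b_k` (`SAW.DKY2014_eq21_holds`) and `c_k ≤ μ^k e^{κ√k}`
(`SAW.Zd.BDGS2012_HammersleyWelsh_holds`) the sequence `h⁺_k r^k` is bounded for `0 ≤ r < 1/μ` and
unbounded for `r > 1/μ`, so the capped Cauchy–Hadamard supremum `xcDim 0 0` equals
`1/μ = SAW.criticalFugacity` (as `μ ≥ 1`, the cap at `1` is harmless).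

Sources: N. Madras, G. Slade, *The Self-Avoiding Walk* (1993), §1.2 (bridges, `(1.2.17)`), §3.1
(half-space walks, Corollary 3.1.6) [MadrasSlade1993]; J. M. Hammersley, D. J. A. Welsh, Quart. J.
Math. Oxford 13 (1962) 108–110. No new definitions.
-/

noncomputable section

open scoped BigOperators Topology symmDiff
open Filter Finset
open Literature.Probability.RandomPlanarGeometry Literature.Probability.LatticeModels

namespace Summit.CriticalPhenomena.SAWScalingLimit.Theorems.AvoidanceLimit.Anchor

/-! Throughout, `h⁺_k` denotes the number of `k`-step self-avoiding walks from `0` all of whose sites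
lie in the box `Λ_k = [-k, k] × [0, k]` (equivalently, in the closed upper half-plane), written out as
`Σ_{b ∈ Λ_k} #{γ ∈ pathsIn ℤ² Λ_k 0 b | |γ| = k}`. -/

/-! ## Taylor coefficients of polynomial functions -/

/-- The iterated derivative of a polynomial function is the polynomial function of the iterated
formal derivative. [folklore] -/
private theorem iterate_deriv_eval (p : Polynomial ℝ) (n : ℕ) :
    deriv^[n] (fun x => p.eval x) = fun x => (Polynomial.derivative^[n] p).eval x := by
  induction n generalizing p with
  | zero => rfl
  | succ n ih =>
    rw [Function.iterate_succ_apply, Function.iterate_succ_apply]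
    have : deriv (fun x => p.eval x) = fun x => (Polynomial.derivative p).eval x :=
      funext fun x => p.deriv
    rw [this, ih]

/-- `(d/dx)^k P (0) = k! · [x^k] P` for a real polynomial `P`. [folklore] -/
private theorem iteratedDeriv_eval_zero (p : Polynomial ℝ) (k : ℕ) :
    iteratedDeriv k (fun x => p.eval x) 0 = (k.factorial : ℝ) * p.coeff k := by
  rw [iteratedDeriv_eq_iterate, iterate_deriv_eval]
  dsimp only
  rw [← Polynomial.coeff_zero_eq_eval_zero, Polynomial.coeff_iterate_derivative, zero_add,
    Nat.descFactorial_self, nsmul_eq_mul]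

/-! ## Two elementary growth lemmas (`e^{O(√k)}` against a geometric sequence) -/

/-- `√k ≤ εk + 1/(4ε)` for `ε > 0`. [folklore] -/
private theorem sqrt_le_linear {ε : ℝ} (hε : 0 < ε) (k : ℕ) : Real.sqrt k ≤ ε * k + 1 / (4 * ε) := by
  have hk : (0 : ℝ) ≤ k := Nat.cast_nonneg k
  have key : ε * (Real.sqrt k - 1 / (2 * ε)) ^ 2 = ε * Real.sqrt k ^ 2 - Real.sqrt k + 1 / (4 * ε) := by
    field_simp
    ring
  rw [Real.sq_sqrt hk] at key
  have h0 : 0 ≤ ε * (Real.sqrt k - 1 / (2 * ε)) ^ 2 := mul_nonneg hε.le (sq_nonneg _)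
  linarith

/-- For `0 ≤ ρ < 1` the sequence `ρ^k e^{κ√k}` is bounded. [folklore] -/
private theorem pow_mul_exp_sqrt_le (κ : ℝ) {ρ : ℝ} (hρ0 : 0 ≤ ρ) (hρ1 : ρ < 1) :
    ∃ C : ℝ, ∀ k : ℕ, ρ ^ k * Real.exp (κ * Real.sqrt k) ≤ C := by
  obtain ⟨σ, hρσ, hσ0, hσ1⟩ : ∃ σ : ℝ, ρ ≤ σ ∧ 0 < σ ∧ σ < 1 :=
    ⟨(ρ + 1) / 2, by linarith, by linarith, by linarith⟩
  have hL : 0 < -Real.log σ := neg_pos.2 (Real.log_neg hσ0 hσ1)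
  have hκ' : 0 < |κ| + 1 := by positivity
  obtain ⟨ε, hεpos, h5⟩ : ∃ ε : ℝ, 0 < ε ∧ (|κ| + 1) * ε = -Real.log σ :=
    ⟨-Real.log σ / (|κ| + 1), div_pos hL hκ', by field_simp⟩
  refine ⟨Real.exp ((|κ| + 1) * (1 / (4 * ε))), fun k => ?_⟩
  have hk0 : (0 : ℝ) ≤ Real.sqrt k := Real.sqrt_nonneg _
  have h1 : ρ ^ k ≤ σ ^ k := pow_le_pow_left₀ hρ0 hρσ k
  have h2 : σ ^ k = Real.exp (k * Real.log σ) := by rw [Real.exp_nat_mul, Real.exp_log hσ0]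
  have h3 : κ * Real.sqrt k ≤ (|κ| + 1) * Real.sqrt k :=
    mul_le_mul_of_nonneg_right (by linarith [le_abs_self κ]) hk0
  have h4 : (|κ| + 1) * Real.sqrt k ≤ (|κ| + 1) * (ε * k + 1 / (4 * ε)) :=
    mul_le_mul_of_nonneg_left (sqrt_le_linear hεpos k) hκ'.le
  have h6 : (|κ| + 1) * (ε * k + 1 / (4 * ε)) = -Real.log σ * k + (|κ| + 1) * (1 / (4 * ε)) := by
    rw [← h5]; ring
  calc ρ ^ k * Real.exp (κ * Real.sqrt k) ≤ σ ^ k * Real.exp ((|κ| + 1) * Real.sqrt k) :=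
        mul_le_mul h1 (Real.exp_le_exp.2 h3) (Real.exp_nonneg _) (pow_nonneg hσ0.le _)
    _ = Real.exp (k * Real.log σ + (|κ| + 1) * Real.sqrt k) := by rw [h2, Real.exp_add]
    _ ≤ Real.exp ((|κ| + 1) * (1 / (4 * ε))) := by
        rw [Real.exp_le_exp]
        linarith

/-- For `ρ > 1` the sequence `e^{-c√k} ρ^k` is unbounded. [folklore] -/
private theorem lt_exp_neg_sqrt_mul_pow (c : ℝ) {ρ : ℝ} (hρ : 1 < ρ) (B : ℝ) :
    ∃ k : ℕ, B < Real.exp (-(c * Real.sqrt k)) * ρ ^ k := by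
  have hL : 0 < Real.log ρ := Real.log_pos hρ
  have hρ0 : 0 < ρ := one_pos.trans hρ
  have hc' : 0 < |c| + 1 := by positivity
  obtain ⟨ε, hεpos, h5⟩ : ∃ ε : ℝ, 0 < ε ∧ (|c| + 1) * ε = Real.log ρ / 2 :=
    ⟨Real.log ρ / (2 * (|c| + 1)), div_pos hL (by positivity), by field_simp⟩
  obtain ⟨k, hk⟩ := exists_nat_gt ((B + (|c| + 1) * (1 / (4 * ε))) * (2 / Real.log ρ))
  refine ⟨k, ?_⟩
  have hk0 : (0 : ℝ) ≤ Real.sqrt k := Real.sqrt_nonneg _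
  have h2 : ρ ^ k = Real.exp (k * Real.log ρ) := by rw [Real.exp_nat_mul, Real.exp_log hρ0]
  have h3 : c * Real.sqrt k ≤ (|c| + 1) * Real.sqrt k :=
    mul_le_mul_of_nonneg_right (by linarith [le_abs_self c]) hk0
  have h4 : (|c| + 1) * Real.sqrt k ≤ (|c| + 1) * (ε * k + 1 / (4 * ε)) :=
    mul_le_mul_of_nonneg_left (sqrt_le_linear hεpos k) hc'.le
  have h6 : (|c| + 1) * (ε * k + 1 / (4 * ε)) = Real.log ρ / 2 * k + (|c| + 1) * (1 / (4 * ε)) := by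
    rw [← h5]; ring
  have hk' : B + (|c| + 1) * (1 / (4 * ε)) < Real.log ρ / 2 * k := by
    have h := mul_lt_mul_of_pos_right hk (div_pos hL two_pos)
    have : (B + (|c| + 1) * (1 / (4 * ε))) * (2 / Real.log ρ) * (Real.log ρ / 2) =
        B + (|c| + 1) * (1 / (4 * ε)) := by
      field_simp
    rw [this] at h
    linarith
  calc B ≤ k * Real.log ρ - c * Real.sqrt k := by linarith
    _ < k * Real.log ρ - c * Real.sqrt k + 1 := lt_add_one _
    _ ≤ Real.exp (k * Real.log ρ - c * Real.sqrt k) := Real.add_one_le_exp _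
    _ = Real.exp (-(c * Real.sqrt k)) * ρ ^ k := by
        rw [h2, ← Real.exp_add]
        congr 1
        ring

/-! ## At `(n, t) = (0, 0)` the half-plane susceptibility of `Λ_N` is the SAW polynomial -/

/-- At dimer fugacity `t = 0` only the empty dimer configuration survives: the dressed SAW is the
tree's strictly dilute loop model `⟨n, 0, x⟩`. (Private copy of the `t = 0` unfolding; the public
name `dimerPF_dimerFugacity_zero` belongs to the companion file of `stub_sawEndpoint`.) [folklore] -/
private theorem dimerPF_zero_dimerFugacity (n x : ℝ) (G : SimpleGraph (Site 2)) [G.LocallyFinite]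
    (Λ A : Finset (Site 2)) :
    dimerPF n 0 x G Λ A = (⟨n, 0, x⟩ : DiluteLoopModel ℝ).partitionFunction G Λ A := by
  have hmem : (∅ : Finset (Sym2 (Site 2))) ∈ dimerConfigs G Λ A := by simp [dimerConfigs]
  have hcov : covered Λ (∅ : Finset (Sym2 (Site 2))) = ∅ := by simp [covered]
  rw [dimerPF, sum_eq_single_of_mem ∅ hmem]
  · simp [hcov]
  · intro M _ hM
    simp [zero_pow (card_ne_zero.2 (nonempty_iff_ne_empty.2 hM))]

/-- The only self-avoiding path from `a` to `a` is the trivial one. [folklore] -/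
private theorem pathsIn_self {G : SimpleGraph (Site 2)} [G.LocallyFinite] {Λ : Finset (Site 2)}
    {a : Site 2} (ha : a ∈ Λ) : DiluteLoopModel.pathsIn G Λ a a = {SimpleGraph.Walk.nil} := by
  ext p
  rw [DiluteLoopModel.mem_pathsIn, mem_singleton]
  constructor
  · rintro ⟨hp, -⟩
    exact (SimpleGraph.Walk.isPath_iff_nil.1 hp).eq_nil
  · rintro rfl
    refine ⟨SimpleGraph.Walk.IsPath.nil, fun v hv => ?_⟩
    rw [SimpleGraph.Walk.support_nil, List.mem_singleton] at hv
    exact hv ▸ ha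

/-- **`twoLegDim 0 0 x ℤ² Λ_N 0 b = Σ_{γ : 0 → b SAW in Λ_N} x^{|γ|}`** for every `b` (for `b = 0`
both sides are `1`: the trivial walk). [cite: MadrasSlade1993, §1.2] -/
private theorem twoLegDim_zero_zero_halfPlaneBox (x : ℝ) (N : ℕ) (b : Site 2) :
    twoLegDim 0 0 x (zdGraph 2) (DiluteLoopModel.halfPlaneBox N) 0 b =
      ∑ p ∈ DiluteLoopModel.pathsIn (zdGraph 2) (DiluteLoopModel.halfPlaneBox N) 0 b,
        x ^ p.length := by
  rw [twoLegDim, dimerPF_zero_dimerFugacity, dimerPF_zero_dimerFugacity,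
    DiluteLoopModel.partitionFunction_zero_zero_empty le_rfl, div_one]
  by_cases hb : (0 : Site 2) = b
  · subst hb
    rw [symmDiff_self, Finset.bot_eq_empty, DiluteLoopModel.partitionFunction_zero_zero_empty le_rfl,
      pathsIn_self (DiluteLoopModel.zero_mem_halfPlaneBox N), sum_singleton,
      SimpleGraph.Walk.length_nil, pow_zero]
  · exact DiluteLoopModel.partitionFunction_zero_zero_eq_sum_paths le_rfl x _ hb

/-- **The `(0, 0)` half-plane susceptibility of `Λ_N` is the polynomial function
`P_N(x) = Σ_{b ∈ Λ_N} Σ_{γ : 0 → b SAW in Λ_N} x^{|γ|}`.** [cite: MadrasSlade1993, §1.2] -/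
private theorem halfPlaneSusceptibilityDim_zero_zero (x : ℝ) (N : ℕ) :
    halfPlaneSusceptibilityDim 0 0 x N =
      (∑ b ∈ DiluteLoopModel.halfPlaneBox N,
        ∑ p ∈ DiluteLoopModel.pathsIn (zdGraph 2) (DiluteLoopModel.halfPlaneBox N) (0 : Site 2) b,
          (Polynomial.X : Polynomial ℝ) ^ p.length).eval x := by
  rw [halfPlaneSusceptibilityDim, Polynomial.eval_finsetSum]
  refine sum_congr rfl fun b _ => ?_
  rw [twoLegDim_zero_zero_halfPlaneBox, Polynomial.eval_finsetSum]
  simp only [Polynomial.eval_pow, Polynomial.eval_X]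

/-- **`chiCoeff 0 0 k = h⁺_k`**: the `k`-th Taylor coefficient at `0` of the `(0, 0)` susceptibility
of `Λ_k` counts the `k`-step self-avoiding walks from `0` inside `Λ_k`. [cite: MadrasSlade1993, §1.2] -/
private theorem chiCoeff_zero_zero (k : ℕ) :
    chiCoeff 0 0 k = ((∑ b ∈ DiluteLoopModel.halfPlaneBox k,
        #((DiluteLoopModel.pathsIn (zdGraph 2) (DiluteLoopModel.halfPlaneBox k) (0 : Site 2) b).filter
          fun p => p.length = k) : ℕ) : ℝ) := by
  have hfun : (fun x : ℝ => halfPlaneSusceptibilityDim 0 0 x k) = fun x =>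
      (∑ b ∈ DiluteLoopModel.halfPlaneBox k,
        ∑ p ∈ DiluteLoopModel.pathsIn (zdGraph 2) (DiluteLoopModel.halfPlaneBox k) (0 : Site 2) b,
          (Polynomial.X : Polynomial ℝ) ^ p.length).eval x :=
    funext fun x => halfPlaneSusceptibilityDim_zero_zero x k
  rw [chiCoeff, hfun, iteratedDeriv_eval_zero,
    mul_div_cancel_left₀ _ (Nat.cast_ne_zero.2 (Nat.factorial_ne_zero k)), Polynomial.finsetSum_coeff,
    Nat.cast_sum]
  refine sum_congr rfl fun b _ => ?_
  rw [Polynomial.finsetSum_coeff, natCast_card_filter]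
  refine sum_congr rfl fun p _ => ?_
  rw [Polynomial.coeff_X_pow]
  by_cases h : p.length = k
  · rw [if_pos h.symm, if_pos h]
  · rw [if_neg (Ne.symm h), if_neg h]

/-! ## `b_k ≤ h⁺_k ≤ c_k` -/

/-- Every site of a walk of `ℤ²` is within `ℓ^∞`-distance `|γ|` of its starting point. [folklore] -/
private theorem abs_sub_le_length {u v : Site 2} (p : (zdGraph 2).Walk u v) :
    ∀ w ∈ p.support, ∀ i, |w i - u i| ≤ p.length := by
  induction p with
  | nil =>
    intro w hw i
    rw [SimpleGraph.Walk.support_nil, List.mem_singleton] at hw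
    subst hw
    simp
  | @cons a b c hab q ih =>
    intro w hw i
    rw [SimpleGraph.Walk.support_cons, List.mem_cons] at hw
    rw [SimpleGraph.Walk.length_cons, Nat.cast_add, Nat.cast_one]
    rcases hw with rfl | hw
    · rw [sub_self, abs_zero]; positivity
    · have h1 := ih w hw i
      have h2 := SAW.Zd.abs_sub_le_one_of_adj hab i
      calc |w i - a i| = |(w i - b i) + (b i - a i)| := by ring_nf
        _ ≤ |w i - b i| + |b i - a i| := abs_add_le _ _
        _ ≤ q.length + 1 := add_le_add h1 h2

/-- `Λ_N ⊆ [-N, N]²`. [folklore] -/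
private theorem halfPlaneBox_subset_box (N : ℕ) : DiluteLoopModel.halfPlaneBox N ⊆ box 2 N := by
  intro v hv
  rw [DiluteLoopModel.mem_halfPlaneBox] at hv
  rw [mem_box, Fin.forall_fin_two]
  exact ⟨hv.1, by linarith [hv.2.1], hv.2.2⟩

/-- **`h⁺_k ≤ c_k`**: a `k`-step self-avoiding walk inside `Λ_k` is a `k`-step self-avoiding walk.
[cite: MadrasSlade1993, §3.1] -/
private theorem hplus_le_count (k : ℕ) :
    ∑ b ∈ DiluteLoopModel.halfPlaneBox k,
        #((DiluteLoopModel.pathsIn (zdGraph 2) (DiluteLoopModel.halfPlaneBox k) (0 : Site 2) b).filter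
          fun p => p.length = k) ≤ SAW.count k := by
  unfold SAW.count
  refine le_trans ?_ (sum_le_sum_of_subset_of_nonneg (halfPlaneBox_subset_box k)
    fun _ _ _ => Nat.zero_le _)
  refine sum_le_sum fun b _ => card_le_card fun p hp => ?_
  rw [mem_filter, DiluteLoopModel.mem_pathsIn] at hp
  rw [mem_filter, SimpleGraph.mem_finsetWalkLength_iff]
  exact ⟨hp.2, hp.1.1⟩

open Classical in
/-- **`b_k ≤ h⁺_k`**: a `k`-step vertical bridge from `0` (`0 < y(γ_i) ≤ y(γ_k)` for `i ≥ 1`) is a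
`k`-step self-avoiding walk all of whose sites lie in `Λ_k`. [cite: MadrasSlade1993, §3.1] -/
private theorem bridgeCount_le_hplus (k : ℕ) :
    SAW.bridgeCount k ≤ ∑ b ∈ DiluteLoopModel.halfPlaneBox k,
        #((DiluteLoopModel.pathsIn (zdGraph 2) (DiluteLoopModel.halfPlaneBox k) (0 : Site 2) b).filter
          fun p => p.length = k) := by
  have key : ∀ v : Site 2,
      (((zdGraph 2).finsetWalkLength k (0 : Site 2) v).filter fun p => SAW.IsBridge p) ⊆
        (DiluteLoopModel.pathsIn (zdGraph 2) (DiluteLoopModel.halfPlaneBox k) (0 : Site 2) v).filter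
          fun p => p.length = k := by
    intro v p hp
    rw [mem_filter, SimpleGraph.mem_finsetWalkLength_iff] at hp
    obtain ⟨hlen, hpath, hsupp⟩ := hp
    rw [mem_filter, DiluteLoopModel.mem_pathsIn]
    refine ⟨⟨hpath, fun w hw => ?_⟩, hlen⟩
    rw [DiluteLoopModel.mem_halfPlaneBox]
    have hb := abs_sub_le_length p w hw
    simp only [Pi.zero_apply, sub_zero, hlen] at hb
    have h0 := abs_le.1 (hb 0)
    have h1 := abs_le.1 (hb 1)
    rcases hsupp w hw with rfl | ⟨hpos, -⟩
    · simp
    · exact ⟨h0, hpos.le, h1.2⟩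
  unfold SAW.bridgeCount
  refine le_of_le_of_eq (sum_le_sum fun v _ => card_le_card (key v)) ?_
  symm
  refine sum_subset (halfPlaneBox_subset_box k) fun v _ hv => ?_
  rw [card_eq_zero, filter_eq_empty_iff]
  intro p hp
  exact absurd ((DiluteLoopModel.mem_pathsIn.1 hp).2 v p.end_mem_support) hv

/-! ## The stub -/

/-- **S7 · `x_c(0, 0) = 1/μ(ℤ²)`**: the intrinsic critical curve of the dressed SAW passes through
the SAW point. With `chiCoeff 0 0 k = h⁺_k` and `b_k ≤ h⁺_k ≤ c_k`, the Hammersley–Welsh bounds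
`e^{-c√k} μ^k ≤ b_k` and `c_k ≤ μ^k e^{κ√k}` make `h⁺_k r^k` bounded for `0 ≤ r < 1/μ` and unbounded
for `r > 1/μ`; as `1/μ ≤ 1`, the supremum over `[0, 1]` defining `xcDim 0 0` is `1/μ`.
[cite: MadrasSlade1993, Corollary 3.1.6] -/
theorem stub_sawCriticalPoint :
    xcDim 0 0 = SAW.criticalFugacity := by
  obtain ⟨c, hc⟩ := SAW.DKY2014_eq21_holds
  obtain ⟨κ, hκ⟩ := SAW.Zd.BDGS2012_HammersleyWelsh_holds 2 le_rfl
  have hμpos : 0 < SAW.connectiveConstant := SAW.Zd.connectiveConstant_pos 2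
  have hμ1 : 1 ≤ SAW.connectiveConstant := SAW.Zd.one_le_connectiveConstant 2
  have hinv1 : SAW.connectiveConstant⁻¹ ≤ 1 := inv_le_one_of_one_le₀ hμ1
  -- `h k = h⁺_k`, with `chiCoeff 0 0 k = h k` and `b_k ≤ h k ≤ c_k`
  obtain ⟨h, hchi0, hbh, hhc⟩ : ∃ h : ℕ → ℕ, (∀ k, chiCoeff 0 0 k = h k) ∧
      (∀ k, SAW.bridgeCount k ≤ h k) ∧ ∀ k, h k ≤ SAW.count k :=
    ⟨_, chiCoeff_zero_zero, bridgeCount_le_hplus, hplus_le_count⟩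
  have hchi : ∀ k : ℕ, |chiCoeff 0 0 k| = (h k : ℝ) := fun k => by
    rw [hchi0]; exact Nat.abs_cast _
  have hcount : ∀ k : ℕ, (SAW.count k : ℝ) ≤
      SAW.connectiveConstant ^ k * Real.exp (κ * Real.sqrt k) := fun k => hκ k
  -- (i) below `1/μ` the sequence `h⁺_k r^k ≤ (μ r)^k e^{κ√k}` is bounded
  have hbelow : ∀ r : ℝ, 0 ≤ r → r < SAW.connectiveConstant⁻¹ →
      BddAbove (Set.range fun k : ℕ => |chiCoeff 0 0 k| * r ^ k) := by
    intro r hr0 hr1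
    have hρ1 : SAW.connectiveConstant * r < 1 := by
      have := mul_lt_mul_of_pos_left hr1 hμpos
      rwa [mul_inv_cancel₀ hμpos.ne'] at this
    obtain ⟨C, hC⟩ := pow_mul_exp_sqrt_le κ (mul_nonneg hμpos.le hr0) hρ1
    refine ⟨C, ?_⟩
    rintro _ ⟨k, rfl⟩
    dsimp only
    rw [hchi]
    calc (h k : ℝ) * r ^ k ≤ (SAW.count k : ℝ) * r ^ k :=
          mul_le_mul_of_nonneg_right (by exact_mod_cast hhc k) (pow_nonneg hr0 _)
      _ ≤ SAW.connectiveConstant ^ k * Real.exp (κ * Real.sqrt k) * r ^ k :=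
          mul_le_mul_of_nonneg_right (hcount k) (pow_nonneg hr0 _)
      _ = (SAW.connectiveConstant * r) ^ k * Real.exp (κ * Real.sqrt k) := by rw [mul_pow]; ring
      _ ≤ C := hC k
  -- (ii) above `1/μ` the sequence `h⁺_k r^k ≥ e^{-c√k} (μ r)^k` is unbounded
  have habove : ∀ r : ℝ, 0 ≤ r → BddAbove (Set.range fun k : ℕ => |chiCoeff 0 0 k| * r ^ k) →
      r ≤ SAW.connectiveConstant⁻¹ := by
    intro r hr0 hbdd
    by_contra hlt
    rw [not_le] at hlt
    have hρ : 1 < SAW.connectiveConstant * r := by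
      rw [mul_comm]; exact (inv_lt_iff_one_lt_mul₀ hμpos).1 hlt
    obtain ⟨B, hB⟩ := hbdd
    obtain ⟨k, hk⟩ := lt_exp_neg_sqrt_mul_pow c hρ B
    have hkB : |chiCoeff 0 0 k| * r ^ k ≤ B := hB ⟨k, rfl⟩
    rw [hchi] at hkB
    have hle : Real.exp (-(c * Real.sqrt k)) * (SAW.connectiveConstant * r) ^ k ≤
        (h k : ℝ) * r ^ k :=
      calc Real.exp (-(c * Real.sqrt k)) * (SAW.connectiveConstant * r) ^ k
          = Real.exp (-(c * Real.sqrt k)) * SAW.connectiveConstant ^ k * r ^ k := by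
            rw [mul_pow, mul_assoc]
        _ ≤ (SAW.bridgeCount k : ℝ) * r ^ k := mul_le_mul_of_nonneg_right (hc k).1 (pow_nonneg hr0 _)
        _ ≤ (h k : ℝ) * r ^ k :=
            mul_le_mul_of_nonneg_right (by exact_mod_cast hbh k) (pow_nonneg hr0 _)
    linarith
  -- (iii) the capped supremum
  have hS0 : (0 : ℝ) ∈ {r : ℝ | 0 ≤ r ∧ r ≤ 1 ∧
      BddAbove (Set.range fun k : ℕ => |chiCoeff 0 0 k| * r ^ k)} :=
    ⟨le_rfl, zero_le_one, hbelow 0 le_rfl (inv_pos.2 hμpos)⟩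
  have hSbdd : BddAbove {r : ℝ | 0 ≤ r ∧ r ≤ 1 ∧
      BddAbove (Set.range fun k : ℕ => |chiCoeff 0 0 k| * r ^ k)} :=
    ⟨1, fun r hr => hr.2.1⟩
  rw [xcDim, SAW.criticalFugacity]
  apply le_antisymm
  · exact csSup_le ⟨0, hS0⟩ fun r hr => habove r hr.1 hr.2.2
  · refine le_of_forall_lt fun r hr => ?_
    rcases lt_or_ge r 0 with hr0 | hr0
    · exact hr0.trans_le (le_csSup hSbdd hS0)
    · obtain ⟨r', hrr', hr'⟩ := exists_between hr
      have hr'0 : 0 ≤ r' := hr0.trans hrr'.le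
      exact hrr'.trans_le (le_csSup hSbdd ⟨hr'0, hr'.le.trans hinv1, hbelow r' hr'0 hr'⟩)

end Summit.CriticalPhenomena.SAWScalingLimit.Theorems.AvoidanceLimit.Anchor

end
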